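import Mathlib

/-!
# Solo-blind kernel #167 — the geometric (adiabatic) term of the slow multiplier is a total derivative plus a dual term

In the plateau analysis (paper §24.97(6), open item (O-γ)) the slow Floquet exponent of the leaf chain
is `∮ λ₀ + ∮ γ + O(P⁻²)` with the geometric term `γ = -⟪π, ẇ⟫ / (1 + ⟪π, w⟫)` built from the frozen
right/left slow eigenvectors.  Writing `p = ⟪π, w⟫`, `a = ⟪π, ẇ⟫`, `b = ⟪π̇, w⟫` (so `p' = a + b`), the
term splits as `γ = -(log (1 + p))' + b / (1 + p)`; over a period the logarithm drops out, so
`∮ γ = ∮ b/(1+p) = ½ ∮ (b - a)/(1+p)`: only the ANTISYMMETRIC (Wronskian) pairing of the left and right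
slow vectors survives.  This file records these three facts for real scalar data.
-/

namespace Summit.AnomalousDissipation.AnomalousDissipation.Theorems

open Real intervalIntegral MeasureTheory

/-- Pointwise split of the geometric term: if `p' = a + b` and `1 + p > 0` then
`t ↦ log (1 + p t)` has derivative `(a + b)/(1 + p)`, i.e. `-a/(1+p) = -(log(1+p))' + b/(1+p)`. -/
theorem geometricTerm_hasDerivAt_log (p a b : ℝ → ℝ) (t : ℝ)
    (hp : HasDerivAt p (a t + b t) t) (hpos : 0 < 1 + p t) :
    HasDerivAt (fun s => Real.log (1 + p s)) ((a t + b t) / (1 + p t)) t := by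
  have h1 : HasDerivAt (fun s => 1 + p s) (a t + b t) t := by
    simpa using hp.const_add 1
  exact h1.log (ne_of_gt hpos)

/-- Over a period of `p` the total-derivative part integrates to zero:
`∫₀ᵀ (a + b)/(1 + p) = 0` when `p T = p 0`. -/
theorem geometricTerm_integral_deriv_eq_zero (p a b : ℝ → ℝ) (T : ℝ)
    (hp : ∀ t, HasDerivAt p (a t + b t) t) (hpos : ∀ t, 0 < 1 + p t) (hper : p T = p 0)
    (hint : IntervalIntegrable (fun t => (a t + b t) / (1 + p t)) volume 0 T) :
    ∫ t in (0 : ℝ)..T, (a t + b t) / (1 + p t) = 0 := by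
  have hderiv : ∀ t ∈ Set.uIcc (0 : ℝ) T,
      HasDerivAt (fun s => Real.log (1 + p s)) ((a t + b t) / (1 + p t)) t :=
    fun t _ => geometricTerm_hasDerivAt_log p a b t (hp t) (hpos t)
  rw [integral_eq_sub_of_hasDerivAt hderiv hint, hper, sub_self]

/-- PERIOD INTEGRAL OF THE GEOMETRIC TERM: with `γ = -a/(1+p)`, `p' = a + b`, `1 + p > 0` and `p`
periodic, `∫₀ᵀ γ = ∫₀ᵀ b/(1+p)` — the pairing may be moved from `⟪π, ẇ⟫` to `⟪π̇, w⟫`. -/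
theorem geometricTerm_period_integral (p a b : ℝ → ℝ) (T : ℝ)
    (hp : ∀ t, HasDerivAt p (a t + b t) t) (hpos : ∀ t, 0 < 1 + p t) (hper : p T = p 0)
    (ha : IntervalIntegrable (fun t => a t / (1 + p t)) volume 0 T)
    (hb : IntervalIntegrable (fun t => b t / (1 + p t)) volume 0 T) :
    ∫ t in (0 : ℝ)..T, -(a t) / (1 + p t) = ∫ t in (0 : ℝ)..T, b t / (1 + p t) := by
  have hint : IntervalIntegrable (fun t => (a t + b t) / (1 + p t)) volume 0 T := by
    have h := ha.add hb
    refine h.congr ?_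
    · intro t _
      ring
  have hzero := geometricTerm_integral_deriv_eq_zero p a b T hp hpos hper hint
  have hsplit : (fun t => -(a t) / (1 + p t)) = fun t => b t / (1 + p t) - (a t + b t) / (1 + p t) := by
    ext t; ring
  rw [hsplit, integral_sub hb hint, hzero, sub_zero]

/-- ANTISYMMETRIC FORM: under the same hypotheses `∫₀ᵀ γ = ½ ∫₀ᵀ (b - a)/(1 + p)`, i.e. only the
Wronskian-type pairing `⟪π̇, w⟫ - ⟪π, ẇ⟫` of the left and right slow vectors contributes over a period. -/
theorem geometricTerm_period_integral_antisym (p a b : ℝ → ℝ) (T : ℝ)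
    (hp : ∀ t, HasDerivAt p (a t + b t) t) (hpos : ∀ t, 0 < 1 + p t) (hper : p T = p 0)
    (ha : IntervalIntegrable (fun t => a t / (1 + p t)) volume 0 T)
    (hb : IntervalIntegrable (fun t => b t / (1 + p t)) volume 0 T) :
    ∫ t in (0 : ℝ)..T, -(a t) / (1 + p t) = (1 / 2) * ∫ t in (0 : ℝ)..T, (b t - a t) / (1 + p t) := by
  have h1 := geometricTerm_period_integral p a b T hp hpos hper ha hb
  have hneg : IntervalIntegrable (fun t => -(a t) / (1 + p t)) volume 0 T := by
    have h := ha.neg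
    refine h.congr ?_
    intro t _
    simp only [Pi.neg_apply]
    ring
  have hsum : ∫ t in (0 : ℝ)..T, (b t - a t) / (1 + p t)
      = (∫ t in (0 : ℝ)..T, b t / (1 + p t)) + ∫ t in (0 : ℝ)..T, -(a t) / (1 + p t) := by
    rw [← integral_add hb hneg]
    congr 1
    ext t; ring
  rw [hsum, ← h1]
  ring

end Summit.AnomalousDissipation.AnomalousDissipation.Theorems
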